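import Summits.Ventures.Crystal3D.Theorems.StickyWulffConstantGenericWallFloorChamber
import Summits.Ventures.Crystal3D.Theorems.StickyWulffConstantGenericWallFloorExactOnlyTransport
import Summits.Ventures.Crystal3D.Theorems.StickyWulffConstantGenericWallFloorSharedOrthogonal
import Summits.Ventures.Crystal3D.Theorems.StickyWulffConstantNoReconstructionGainSymmetry
import Summits.Ventures.Crystal3D.Theorems.StickyWulffConstantGenericWallFloorSlotDozens
import HarnessLib

/-!
# Star transport: ONE `ExactOnly` certificate for the closed vertex star (C12-55) serves every frame,
# centre and slot (crux `GenericWallFloor`, line `WallLedgerG`; E1 ↔ chain-ledger glue)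

HONEST FRAMING. Part of the venture `Summits/Ventures/Crystal3D` (cell `crystal3d-full`), helper
`--supports` the crux `GenericWallFloor` (stmt-Ventures-19480), registered line `WallLedgerG`, open stub
`stub_twoSlabAdhesion`.  The planner's chain ledger (ROUTE §81(3)/(7), N-TC `twoSlabAdhesion_chainLedger`)
takes «`ExactOnly` of C12-55 (the closed vertex star `{a} ∪ N(a)`) BY NAME» and applies it at every top
`t` of every grain line, in the grain's frame `A`, at the slot `−δ₀`.  This file is the glue that makes ONE
certificate suffice:

* `exists_latticeIso_map_slot` — SLOT TRANSITIVITY of the cubic group inside the tree's vocabulary: for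
  any two slots `s, s'` a product of at most two bond mirrors (`bondReflection_mem_fcc`,
  …NoReconstructionGainSymmetry) and possibly `−1` is a linear isometry preserving `Λ₀` with `g s = s'`;
  `image_star_eq` — lattice isometries permute closed vertex stars (`star s = {w ∈ fccSlots : ⟪w,s⟫ > 0}`);
* **`exactOnly_star_transport`** — `ExactOnly 0 (star s₀)` for ONE slot `s₀` ⇒
  `ExactOnly t ((star δ).image (t + A ·))` for every frame `A`, centre `t`, slot `δ` (`ExactOnly.image`);
* `exactOnly_star_of_cubic` / **`exactOnly_star_transport_cubic`** — the same starting from the star of a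
  vector of `fccKissingPattern`, the CUBIC frame in which the cone certificates (…ConeCertificateDefs,
  row C12-55 = P₅) are written (`exists_linearIsometryEquiv_unitShell_eq`);
* `exactOnly_top_of_star_certificate` — combined with TC-2 (`top_owns_closedStar`, …Chamber): the own
  part of a top `b + A δ₀` over a covered ball is exact-only, i.e. the `hO` hypothesis of
  `trichotomy_of_exactOnly` at every top of the ledger.

WHAT THIS IS NOT: no certificate is proved here (E1: outside-tube R39c open); rung F-C1 not moved.
-/

noncomputable section

namespace Summit.Ventures.Crystal3D.Theorems

open Finset
open Literature.MathematicalPhysics.StatisticalMechanics (fccStacking)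
open scoped InnerProductSpace

/-! ### Lattice isometries -/

/-- A lattice isometry maps slots to slots. -/
theorem map_mem_fccSlots (g : EuclideanSpace ℝ (Fin 3) ≃ₗᵢ[ℝ] EuclideanSpace ℝ (Fin 3))
    (hg : ∀ p ∈ fccStacking 1 (Real.sqrt (2 / 3)), g p ∈ fccStacking 1 (Real.sqrt (2 / 3)))
    {w : EuclideanSpace ℝ (Fin 3)} (hw : w ∈ fccSlots) : g w ∈ fccSlots :=
  mem_fccSlots_of_unit (hg w (mem_fcc_of_mem_fccSlots hw))
    (by rw [LinearIsometryEquiv.norm_map, norm_eq_one_of_mem_fccSlots hw])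

/-- **Closed vertex stars are permuted by lattice isometries**: `g (star s) = star (g s)`, where the
closed vertex star of a slot `s` is `{w ∈ fccSlots : ⟪w, s⟫ > 0} = {s} ∪ N(s)`. -/
theorem image_star_eq (g : EuclideanSpace ℝ (Fin 3) ≃ₗᵢ[ℝ] EuclideanSpace ℝ (Fin 3))
    (hg : ∀ p ∈ fccStacking 1 (Real.sqrt (2 / 3)), g p ∈ fccStacking 1 (Real.sqrt (2 / 3)))
    (hg' : ∀ p ∈ fccStacking 1 (Real.sqrt (2 / 3)), g.symm p ∈ fccStacking 1 (Real.sqrt (2 / 3)))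
    (s : EuclideanSpace ℝ (Fin 3)) :
    (fccSlots.filter fun w => 0 < ⟪w, s⟫_ℝ).image g = fccSlots.filter fun w => 0 < ⟪w, g s⟫_ℝ := by
  classical
  ext w'
  simp only [Finset.mem_image, Finset.mem_filter]
  constructor
  · rintro ⟨w, ⟨hw, hpos⟩, rfl⟩
    exact ⟨map_mem_fccSlots g hg hw, by rwa [LinearIsometryEquiv.inner_map_map]⟩
  · rintro ⟨hw', hpos⟩
    refine ⟨g.symm w', ⟨map_mem_fccSlots g.symm hg' hw', ?_⟩, g.apply_symm_apply w'⟩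
    rw [← g.inner_map_map, g.apply_symm_apply]; exact hpos

/-- The bond mirror of a slot is a lattice isometry (both directions). -/
theorem bondReflection_latticeIso {v : EuclideanSpace ℝ (Fin 3)} (hv : v ∈ fccSlots) :
    (∀ p ∈ fccStacking 1 (Real.sqrt (2 / 3)), (ℝ ∙ v)ᗮ.reflection p ∈ fccStacking 1 (Real.sqrt (2 / 3))) ∧
    (∀ p ∈ fccStacking 1 (Real.sqrt (2 / 3)),
      ((ℝ ∙ v)ᗮ.reflection).symm p ∈ fccStacking 1 (Real.sqrt (2 / 3))) := by
  refine ⟨fun p hp => bondReflection_mem_fcc (mem_fcc_of_mem_fccSlots hv) (norm_eq_one_of_mem_fccSlots hv) hp,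
    fun p hp => ?_⟩
  rw [bondReflection_symm]
  exact bondReflection_mem_fcc (mem_fcc_of_mem_fccSlots hv) (norm_eq_one_of_mem_fccSlots hv) hp

/-- The bond mirror of `v = s − s'` (adjacent slots) maps `s` to `s'`. -/
theorem bondReflection_map_adj {s s' : EuclideanSpace ℝ (Fin 3)} (hs : s ∈ fccSlots) (hs' : s' ∈ fccSlots)
    (h : ⟪s, s'⟫_ℝ = 1 / 2) : (ℝ ∙ (s - s'))ᗮ.reflection s = s' := by
  have hv : s - s' ∈ fccSlots := sub_mem_fccSlots_of_inner_eq_half hs hs' h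
  rw [bondReflection_apply _ _ (norm_eq_one_of_mem_fccSlots hv), inner_sub_left,
    real_inner_self_eq_norm_sq, norm_eq_one_of_mem_fccSlots hs, real_inner_comm, h]
  norm_num

/-- **Slot transitivity of the lattice symmetries.**  For any two slots `s, s'` there is a linear
isometry `g` preserving `Λ₀` (in both directions) with `g s = s'` — a product of at most two bond
mirrors and possibly `−1`. -/
theorem exists_latticeIso_map_slot {s s' : EuclideanSpace ℝ (Fin 3)} (hs : s ∈ fccSlots) (hs' : s' ∈ fccSlots) :
    ∃ g : EuclideanSpace ℝ (Fin 3) ≃ₗᵢ[ℝ] EuclideanSpace ℝ (Fin 3),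
      (∀ p ∈ fccStacking 1 (Real.sqrt (2 / 3)), g p ∈ fccStacking 1 (Real.sqrt (2 / 3))) ∧
      (∀ p ∈ fccStacking 1 (Real.sqrt (2 / 3)), g.symm p ∈ fccStacking 1 (Real.sqrt (2 / 3))) ∧
      g s = s' := by
  -- negation is a lattice isometry
  have hneg : (∀ p ∈ fccStacking 1 (Real.sqrt (2 / 3)),
      (LinearIsometryEquiv.neg ℝ : EuclideanSpace ℝ (Fin 3) ≃ₗᵢ[ℝ] EuclideanSpace ℝ (Fin 3)) p ∈
        fccStacking 1 (Real.sqrt (2 / 3))) ∧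
      (∀ p ∈ fccStacking 1 (Real.sqrt (2 / 3)),
      (LinearIsometryEquiv.neg ℝ : EuclideanSpace ℝ (Fin 3) ≃ₗᵢ[ℝ] EuclideanSpace ℝ (Fin 3)).symm p ∈
        fccStacking 1 (Real.sqrt (2 / 3))) :=
    ⟨fun p hp => fcc_neg_mem hp, fun p hp => fcc_neg_mem hp⟩
  -- composition of lattice isometries
  have htrans : ∀ g h : EuclideanSpace ℝ (Fin 3) ≃ₗᵢ[ℝ] EuclideanSpace ℝ (Fin 3),
      ((∀ p ∈ fccStacking 1 (Real.sqrt (2 / 3)), g p ∈ fccStacking 1 (Real.sqrt (2 / 3))) ∧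
        (∀ p ∈ fccStacking 1 (Real.sqrt (2 / 3)), g.symm p ∈ fccStacking 1 (Real.sqrt (2 / 3)))) →
      ((∀ p ∈ fccStacking 1 (Real.sqrt (2 / 3)), h p ∈ fccStacking 1 (Real.sqrt (2 / 3))) ∧
        (∀ p ∈ fccStacking 1 (Real.sqrt (2 / 3)), h.symm p ∈ fccStacking 1 (Real.sqrt (2 / 3)))) →
      ((∀ p ∈ fccStacking 1 (Real.sqrt (2 / 3)), (g.trans h) p ∈ fccStacking 1 (Real.sqrt (2 / 3))) ∧
        (∀ p ∈ fccStacking 1 (Real.sqrt (2 / 3)), (g.trans h).symm p ∈ fccStacking 1 (Real.sqrt (2 / 3)))) := by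
    intro g h hg hh
    exact ⟨fun p hp => hh.1 _ (hg.1 p hp), fun p hp => hg.2 _ (hh.2 p hp)⟩
  rcases inner_slots_mem hs hs' with h | h | h | h | h
  · -- `s' = s`
    refine ⟨LinearIsometryEquiv.refl ℝ _, fun p hp => hp, fun p hp => hp, ?_⟩
    rw [eq_of_inner_eq_one hs hs' h]; rfl
  · -- adjacent: one bond mirror
    exact ⟨_, (bondReflection_latticeIso (sub_mem_fccSlots_of_inner_eq_half hs hs' h)).1,
      (bondReflection_latticeIso (sub_mem_fccSlots_of_inner_eq_half hs hs' h)).2, bondReflection_map_adj hs hs' h⟩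
  · -- orthogonal: through a common apex `c`
    obtain ⟨c, hc, -, -, -, hc1, -, hcs, hcs', -, -⟩ := exists_two_apices (mem_fcc_of_mem_fccSlots hs)
      (mem_fcc_of_mem_fccSlots hs') (norm_eq_one_of_mem_fccSlots hs) (norm_eq_one_of_mem_fccSlots hs') h
    have hcS : c ∈ fccSlots := mem_fccSlots_of_unit hc hc1
    have h1 : ⟪s, c⟫_ℝ = 1 / 2 := by rw [real_inner_comm]; exact hcs
    have h2 : ⟪c, s'⟫_ℝ = 1 / 2 := hcs'
    set g₁ := (ℝ ∙ (s - c))ᗮ.reflection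
    set g₂ := (ℝ ∙ (c - s'))ᗮ.reflection
    refine ⟨g₁.trans g₂, (htrans g₁ g₂ (bondReflection_latticeIso (sub_mem_fccSlots_of_inner_eq_half hs hcS h1))
      (bondReflection_latticeIso (sub_mem_fccSlots_of_inner_eq_half hcS hs' h2))).1,
      (htrans g₁ g₂ (bondReflection_latticeIso (sub_mem_fccSlots_of_inner_eq_half hs hcS h1))
      (bondReflection_latticeIso (sub_mem_fccSlots_of_inner_eq_half hcS hs' h2))).2, ?_⟩
    show g₂ (g₁ s) = s'
    rw [bondReflection_map_adj hs hcS h1, bondReflection_map_adj hcS hs' h2]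
  · -- at `120°`: mirror to `−s'`, then negate
    have hns' : -s' ∈ fccSlots := neg_mem_fccSlots hs'
    have h1 : ⟪s, -s'⟫_ℝ = 1 / 2 := by rw [inner_neg_right, h]; norm_num
    set g₁ := (ℝ ∙ (s - -s'))ᗮ.reflection
    refine ⟨g₁.trans (LinearIsometryEquiv.neg ℝ),
      (htrans g₁ _ (bondReflection_latticeIso (sub_mem_fccSlots_of_inner_eq_half hs hns' h1)) hneg).1,
      (htrans g₁ _ (bondReflection_latticeIso (sub_mem_fccSlots_of_inner_eq_half hs hns' h1)) hneg).2, ?_⟩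
    show -(g₁ s) = s'
    rw [bondReflection_map_adj hs hns' h1, neg_neg]
  · -- antipodal: negate
    refine ⟨LinearIsometryEquiv.neg ℝ, hneg.1, hneg.2, ?_⟩
    show -s = s'
    rw [eq_neg_of_inner_eq_neg_one hs hs' h]

/-! ### The transport theorem -/

/-- **STAR TRANSPORT.**  If the closed vertex star of ONE slot `s₀` of `Λ₀`, as an own pattern around the
origin, is exact-only (the E1 row C12-55 in the venture's frame), then for EVERY grain frame `A`, EVERY
centre `t` and EVERY slot `δ` the own pattern `{t + A w : w ∈ star δ}` is exact-only around `t` — the form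
in which the chain ledger (§81(3) TC-3: `own₁(τ(ℓ)) ⊇` closed star of `−δ₀`) consumes the certificate via
`ExactOnly.mono` and `trichotomy_of_exactOnly`. -/
theorem exactOnly_star_transport {s₀ : EuclideanSpace ℝ (Fin 3)} (hs₀ : s₀ ∈ fccSlots)
    (h : ExactOnly 0 (fccSlots.filter fun w => 0 < ⟪w, s₀⟫_ℝ))
    (A : EuclideanSpace ℝ (Fin 3) ≃ₗᵢ[ℝ] EuclideanSpace ℝ (Fin 3)) (t : EuclideanSpace ℝ (Fin 3))
    {δ : EuclideanSpace ℝ (Fin 3)} (hδ : δ ∈ fccSlots) :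
    ExactOnly t ((fccSlots.filter fun w => 0 < ⟪w, δ⟫_ℝ).image fun w => t + A w) := by
  classical
  obtain ⟨g, hg, hg', hgs⟩ := exists_latticeIso_map_slot hs₀ hδ
  have himg := h.image (g.trans A) t
  rw [map_zero, zero_add] at himg
  have hset : ((fccSlots.filter fun w => 0 < ⟪w, δ⟫_ℝ).image fun w => t + A w) =
      (fccSlots.filter fun w => 0 < ⟪w, s₀⟫_ℝ).image (fun x => (g.trans A) x + t) := by
    rw [← hgs, ← image_star_eq g hg hg' s₀, Finset.image_image]
    refine Finset.image_congr fun w _ => ?_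
    show t + A (g w) = (g.trans A) w + t
    rw [LinearIsometryEquiv.trans_apply, add_comm]
  rw [hset]; exact himg

/-! ### From the cubic frame of the certificates to the venture's slots -/

/-- **Cubic → Barlow.**  An `ExactOnly` certificate for the closed vertex star of a vector `p₀` of the
cuboctahedron `fccKissingPattern` (the frame of `KissingPatterns` / the cone certificates, row C12-55)
yields one for the closed vertex star of a slot of `Λ₀`. -/
theorem exactOnly_star_of_cubic {p₀ : EuclideanSpace ℝ (Fin 3)}
    (hp₀ : p₀ ∈ Literature.Geometry.DiscreteGeometry.fccKissingPattern)
    (h : ExactOnly 0 (Literature.Geometry.DiscreteGeometry.fccKissingPattern.filter fun p => 0 < ⟪p, p₀⟫_ℝ)) :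
    ∃ s₀ ∈ fccSlots, ExactOnly 0 (fccSlots.filter fun w => 0 < ⟪w, s₀⟫_ℝ) := by
  classical
  obtain ⟨L₀, hL₀⟩ := exists_linearIsometryEquiv_unitShell_eq
  have toSlot : ∀ {p}, p ∈ Literature.Geometry.DiscreteGeometry.fccKissingPattern → L₀ p ∈ fccSlots := by
    intro p hp
    have : L₀ p ∈ {w | w ∈ fccStacking 1 (Real.sqrt (2 / 3)) ∧ ‖w‖ = 1} := by rw [hL₀]; exact ⟨p, hp, rfl⟩
    exact mem_fccSlots_of_unit this.1 this.2
  have toPat : ∀ {w}, w ∈ fccSlots → ∃ p ∈ Literature.Geometry.DiscreteGeometry.fccKissingPattern, L₀ p = w := by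
    intro w hw
    have : w ∈ {w | w ∈ fccStacking 1 (Real.sqrt (2 / 3)) ∧ ‖w‖ = 1} :=
      ⟨mem_fcc_of_mem_fccSlots hw, norm_eq_one_of_mem_fccSlots hw⟩
    rw [hL₀] at this
    obtain ⟨p, hp, hpw⟩ := this
    exact ⟨p, hp, hpw⟩
  refine ⟨L₀ p₀, toSlot hp₀, ?_⟩
  have himg := h.image L₀ 0
  rw [map_zero, zero_add] at himg
  convert himg using 2
  ext w
  simp only [Finset.mem_filter, Finset.mem_image, add_zero]
  constructor
  · rintro ⟨hw, hpos⟩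
    obtain ⟨p, hp, rfl⟩ := toPat hw
    exact ⟨p, ⟨hp, by rwa [LinearIsometryEquiv.inner_map_map] at hpos⟩, rfl⟩
  · rintro ⟨p, ⟨hp, hpos⟩, rfl⟩
    exact ⟨toSlot hp, by rwa [LinearIsometryEquiv.inner_map_map]⟩

/-- **STAR TRANSPORT from a cubic-frame certificate**: one `ExactOnly` row for the closed vertex star in
the frame of the cone certificates gives exact-only own patterns `{t + A w : w ∈ star δ}` at every centre,
frame and slot. -/
theorem exactOnly_star_transport_cubic {p₀ : EuclideanSpace ℝ (Fin 3)}
    (hp₀ : p₀ ∈ Literature.Geometry.DiscreteGeometry.fccKissingPattern)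
    (h : ExactOnly 0 (Literature.Geometry.DiscreteGeometry.fccKissingPattern.filter fun p => 0 < ⟪p, p₀⟫_ℝ))
    (A : EuclideanSpace ℝ (Fin 3) ≃ₗᵢ[ℝ] EuclideanSpace ℝ (Fin 3)) (t : EuclideanSpace ℝ (Fin 3))
    {δ : EuclideanSpace ℝ (Fin 3)} (hδ : δ ∈ fccSlots) :
    ExactOnly t ((fccSlots.filter fun w => 0 < ⟪w, δ⟫_ℝ).image fun w => t + A w) := by
  obtain ⟨s₀, hs₀, h₀⟩ := exactOnly_star_of_cubic hp₀ h
  exact exactOnly_star_transport hs₀ h₀ A t hδ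

/-- **The closed vertex star has five members** is not needed here; what the ledger uses is the
IDENTIFICATION of TC-2's own pattern with a transported star: for a top `t = b + A δ₀` over a covered
ball, `own(t) ⊇ {t + A w : 0 < ⟪w, −δ₀⟫}` (`top_owns_closedStar`, …Chamber), so
`ExactOnly t (own t)` follows from the C12-55 row by `exactOnly_star_transport(_cubic)` + `ExactOnly.mono`. -/
theorem exactOnly_top_of_star_certificate {X : Finset (EuclideanSpace ℝ (Fin 3))}
    {s₀ : EuclideanSpace ℝ (Fin 3)} (hs₀ : s₀ ∈ fccSlots)
    (hcert : ExactOnly 0 (fccSlots.filter fun w => 0 < ⟪w, s₀⟫_ℝ))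
    (A : EuclideanSpace ℝ (Fin 3) ≃ₗᵢ[ℝ] EuclideanSpace ℝ (Fin 3)) (n : EuclideanSpace ℝ (Fin 3))
    {δ₀ : EuclideanSpace ℝ (Fin 3)} (hδ₀ : δ₀ ∈ fccSlots)
    (hmax : ∀ w ∈ fccSlots, w ≠ δ₀ → ⟪A w, n⟫_ℝ < ⟪A δ₀, n⟫_ℝ)
    {b : EuclideanSpace ℝ (Fin 3)} (hb : b ∈ X) (hcov : ∀ w ∈ fccSlots, 0 < ⟪A w, n⟫_ℝ → b + A w ∈ X)
    {O : Finset (EuclideanSpace ℝ (Fin 3))}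
    (hO : ∀ w ∈ fccSlots, b + A δ₀ + A w ∈ X → b + A δ₀ + A w ∈ O) :
    ExactOnly (b + A δ₀) O := by
  classical
  have hstar := exactOnly_star_transport hs₀ hcert A (b + A δ₀) (neg_mem_fccSlots hδ₀)
  refine hstar.mono ?_
  intro x hx
  obtain ⟨w, hw, rfl⟩ := Finset.mem_image.1 hx
  obtain ⟨hwS, hpos⟩ := Finset.mem_filter.1 hw
  have hlt : ⟪A w, A δ₀⟫_ℝ < 0 := by
    rw [LinearIsometryEquiv.inner_map_map]; rw [inner_neg_right] at hpos; linarith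
  exact hO w hwS (top_owns_closedStar A n hδ₀ hmax hb hcov hwS hlt)

end Summit.Ventures.Crystal3D.Theorems

end
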